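import Summits.CriticalPhenomena.CardyFormulaZ2.Theorems.CardySelfRefinementLagHandOffStairCutsTopology
import HarnessLib

/-!
# Plane topology for the staircase cross-cuts, II: legs, and two lattice points in an open set

Helper module for the registered stubs `stub_quadTransfer_stairArcThrough` /
`stub_quadTransfer_noIdleRelStairCuts` of line `hitting-tournament` of crux
`CardySelfRefinement.LagHandOff` (stmt-CriticalPhenomena-10268), method step (d) of
`stub_quadTransfer`; continues `…StairCutsTopology.lean`.

* `stub_quadTransfer_stairLeg` (registered stub) — inside an open preconnected `W`, from a lattice point `δ X ∈ W` to a lattice point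
  `δ Q` through its neighbour `δ T ∈ W`: a SELF-AVOIDING walk of a finer lattice `δ / M` whose mesh
  trace lies in a set `N ⊆ W` that stays `4δ/M` away from the complement of `W`, together with the
  closed coarse edge `[δ Q, δ T]` (shadow a path, append the straight run `T → Q`, erase loops with
  `SimpleGraph.Walk.bypass`);
* `isSimpleArc_meshTrace` — the mesh trace of a self-avoiding walk is a simple arc;
* `exists_finset_edge` — a closed lattice edge of a rational mesh as a union of rational segments;
* `exists_two_latticePoints` — in a nonempty open `V`, two horizontally adjacent points of a fine
  lattice `(h / M₀) ℤ²` and a small horizontal segment at the second one, all inside `V`, the segment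
  missing the first point.
-/

noncomputable section

open Set Metric
open Literature.Topology.PlaneTopology Literature.Probability.LatticeModels
open Literature.Probability.Percolation

namespace Summit.CriticalPhenomena.CardyFormulaZ2.Cruxes.LagHandOff.HittingTournament

/-! ### Legs -/

/-- **A leg.** Let `W` be open and preconnected, `δ > 0`, `X` a site with `δ X ∈ W`, and `Q ∼ T`
adjacent sites with `δ T ∈ W`.  Then for some `M ≥ 1` there is a self-avoiding walk of the finer
lattice (mesh `δ / M`) from (the refinement of) `X` to (the refinement of) `Q` whose mesh trace
lies in `N ∪ [δ Q, δ T]` for a set `N ⊆ W` every point of which is at distance `≥ 4δ/M` from every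
point outside `W` (`N` is the `4δ/M`-neighbourhood of a path from `δ X` to `δ T` in `W` admitting
the margin `8δ/M`). -/
theorem stub_quadTransfer_stairLeg :
    ∀ (W : Set ℂ), IsOpen W → IsPreconnected W → ∀ (δ : ℝ), 0 < δ → ∀ (X Q T : Site 2),
      (zdGraph 2).Adj Q T → meshPoint δ X ∈ W → meshPoint δ T ∈ W →
      ∃ (M : ℕ) (leg : (zdGraph 2).Walk ((M : ℤ) • X) ((M : ℤ) • Q)) (N : Set ℂ),
        M ≠ 0 ∧ leg.IsPath ∧ N ⊆ W ∧ (∀ z ∈ N, ∀ e, e ∉ W → 4 * (δ / M) ≤ dist z e) ∧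
        meshTrace (δ / M) leg ⊆ N ∪ segment ℝ (meshPoint δ Q) (meshPoint δ T) := by
  intro W hW hWc δ hδ X Q T hQT hX hT
  -- a path from `δ X` to `δ T` inside `W`, with a margin `ρ`
  have hWpc : IsPathConnected W := (hW.isConnected_iff_isPathConnected).1 ⟨⟨_, hX⟩, hWc⟩
  obtain ⟨γ, hγ⟩ := hWpc.joinedIn _ hX _ hT
  have hCc : IsCompact (range γ) := isCompact_range γ.continuous
  have hCW : range γ ⊆ W := by
    rintro _ ⟨t, rfl⟩
    exact hγ t
  obtain ⟨ρ, hρ, hρW⟩ := hCc.exists_cthickening_subset_open hW hCW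
  -- the fine mesh `δ / M ≤ ρ / 8`
  obtain ⟨M, hM⟩ := exists_nat_ge (8 * δ / ρ)
  have hMpos : (0 : ℝ) < M := lt_of_lt_of_le (by positivity) hM
  have hM0 : M ≠ 0 := by
    rintro rfl
    simp at hMpos
  have h8 : 8 * (δ / M) ≤ ρ := by
    rw [mul_div_assoc', div_le_iff₀ hMpos]
    rw [div_le_iff₀ hρ] at hM
    linarith
  have hδ'pos : 0 < δ / M := div_pos hδ hMpos
  -- shadow of the path at mesh `δ / M`, from `M X` to `M T`
  have eX : meshPoint (δ / M) ((M : ℤ) • X) = meshPoint δ X := meshPoint_div_smul hM0 X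
  have eT : meshPoint (δ / M) ((M : ℤ) • T) = meshPoint δ T := meshPoint_div_smul hM0 T
  obtain ⟨π, hπ⟩ := stub_quadTransfer_latticeShadow _ hδ'pos _ _ (γ.cast eX eT)
  -- the straight run from `M T` back to `M Q`
  have hend : (fun w : Site 2 => w + (Q - T))^[M] ((M : ℤ) • T) = (M : ℤ) • Q := by
    rw [iterate_add_right_eq, smul_sub, add_sub_cancel]
  set full : (zdGraph 2).Walk ((M : ℤ) • X) ((M : ℤ) • Q) :=
    π.append ((runWalk (Q - T) (zdGraph_adj_zero_sub hQT.symm) ((M : ℤ) • T) M).copy rfl hend)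
    with hfull
  refine ⟨M, full.bypass, thickening (4 * (δ / M)) (range γ), hM0, full.bypass_isPath,
    (thickening_subset_cthickening_of_le (by linarith) _).trans hρW, ?_, ?_⟩
  · -- points of the neighbourhood are `4 δ/M`-far from the complement of `W`
    intro z hz e he
    by_contra hlt
    push Not at hlt
    obtain ⟨c, hc, hzc⟩ := mem_thickening_iff.1 hz
    refine he (hρW (mem_cthickening_of_dist_le e c ρ _ hc ?_))
    linarith [dist_triangle e z c, dist_comm z e]
  · refine (meshTrace_bypass_subset _ full).trans ?_
    rw [hfull, meshTrace_append, meshTrace_copy]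
    refine union_subset_union (fun z hz => ?_) ?_
    · obtain ⟨t, ht⟩ := hπ z hz
      exact mem_thickening_iff.2 ⟨γ t, ⟨t, rfl⟩, ht⟩
    · rw [segment_symm]
      exact meshTrace_runWalk_subset hM0 hQT.symm

/-- **The mesh trace of a self-avoiding lattice walk is a simple arc** between the mesh points of
its endpoints (`isSimpleArc_walkTrace` rescaled). -/
theorem isSimpleArc_meshTrace {δ : ℝ} (hδ : 0 < δ) {u v : Site 2} {W : (zdGraph 2).Walk u v}
    (hW : W.IsPath) (hn : ¬ W.Nil) :
    IsSimpleArc (meshTrace δ W) (meshPoint δ u) (meshPoint δ v) := by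
  have hc : Continuous (meshScale δ) := (meshScale δ).continuous_of_finiteDimensional
  have hi : Function.Injective (meshScale δ) := fun a b hab => by
    simpa [meshScale_apply, hδ.ne'] using hab
  have := (isSimpleArc_walkTrace hW hn).image hc hi
  rwa [← meshPoint_eq_meshScale, ← meshPoint_eq_meshScale] at this

/-- A closed lattice edge of a rational mesh is a (one-element) union of axis-parallel rational
segments. -/
theorem exists_finset_edge (h : ℚ) {g g' : Site 2} (hgg' : (zdGraph 2).Adj g g') :
    ∃ S : Finset ((ℚ × ℚ) × (ℚ × ℚ)), (∀ s ∈ S, s.1.1 = s.2.1 ∨ s.1.2 = s.2.2) ∧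
      segment ℝ (meshPoint (h : ℝ) g) (meshPoint (h : ℝ) g') =
        ⋃ s ∈ S, segment ℝ (⟨(s.1.1 : ℝ), (s.1.2 : ℝ)⟩ : ℂ) ⟨(s.2.1 : ℝ), (s.2.2 : ℝ)⟩ := by
  obtain ⟨S, hS, hSeq⟩ :=
    exists_finset_meshTrace h (SimpleGraph.Walk.cons hgg' (SimpleGraph.Walk.nil : (zdGraph 2).Walk g' g'))
  refine ⟨S, hS, ?_⟩
  rw [← hSeq]
  simp only [meshTrace, walkTrace_cons, walkTrace_nil, union_empty, ← segment_meshPoint_eq_image]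

/-! ### Two lattice points and a small segment inside an open set -/

/-- **Two horizontally adjacent points of a fine lattice `(h/M₀) ℤ²` inside a nonempty open set
`V`**, and the horizontal segment of length `h/(2M₀)` to the right of the second one: all inside
`V`, the segment missing the first point and non-degenerate. -/
theorem exists_two_latticePoints {V : Set ℂ} (hV : IsOpen V) (hVne : V.Nonempty) {h : ℝ}
    (hh : 0 < h) :
    ∃ (M₀ : ℕ) (a₁ : Site 2), M₀ ≠ 0 ∧ meshPoint (h / M₀) a₁ ∈ V ∧
      meshPoint (h / M₀) (a₁ + Pi.single 0 1) ∈ V ∧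
      segment ℝ (meshPoint (h / M₀) (a₁ + Pi.single 0 1))
        (meshPoint (h / M₀) (a₁ + Pi.single 0 1) + (((h / M₀) / 2 : ℝ) : ℂ)) ⊆ V ∧
      meshPoint (h / M₀) a₁ ∉ segment ℝ (meshPoint (h / M₀) (a₁ + Pi.single 0 1))
        (meshPoint (h / M₀) (a₁ + Pi.single 0 1) + (((h / M₀) / 2 : ℝ) : ℂ)) ∧
      meshPoint (h / M₀) (a₁ + Pi.single 0 1) ≠
        meshPoint (h / M₀) (a₁ + Pi.single 0 1) + (((h / M₀) / 2 : ℝ) : ℂ) := by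
  obtain ⟨v, hv⟩ := hVne
  obtain ⟨ρv, hρv, hballV⟩ := Metric.isOpen_iff.1 hV v hv
  obtain ⟨M₀, hM₀⟩ := exists_nat_gt (4 * h / ρv)
  have hM₀pos : (0 : ℝ) < M₀ := lt_trans (by positivity) hM₀
  have hM₀ne : M₀ ≠ 0 := by
    rintro rfl
    simp at hM₀pos
  set δ₀ : ℝ := h / M₀ with hδ₀
  have hδ₀pos : 0 < δ₀ := div_pos hh hM₀pos
  have h4δ₀ : 4 * δ₀ < ρv := by
    rw [hδ₀, mul_div_assoc', div_lt_iff₀ hM₀pos]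
    rw [div_lt_iff₀ hρv] at hM₀
    linarith
  have hfl : ∀ q : ℝ, δ₀ * ⌊q / δ₀⌋ ≤ q ∧ q < δ₀ * ⌊q / δ₀⌋ + δ₀ := fun q => by
    have h1 := (le_div_iff₀ hδ₀pos).1 (Int.floor_le (q / δ₀))
    have h2 := (div_lt_iff₀ hδ₀pos).1 (Int.lt_floor_add_one (q / δ₀))
    constructor <;> linarith
  set a₁ : Site 2 := ![⌊v.re / δ₀⌋, ⌊v.im / δ₀⌋] with ha₁
  set x₁ : ℂ := meshPoint δ₀ a₁ with hx₁
  set x₂ : ℂ := meshPoint δ₀ (a₁ + Pi.single 0 1) with hx₂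
  have hx₁v : dist x₁ v ≤ 2 * δ₀ := by
    have hre : |x₁.re - v.re| ≤ δ₀ := by
      have e : x₁.re = δ₀ * ⌊v.re / δ₀⌋ := by simp [hx₁, ha₁, meshPoint_re]
      obtain ⟨h1, h2⟩ := hfl v.re
      rw [e, abs_le]
      constructor <;> linarith
    have him : |x₁.im - v.im| ≤ δ₀ := by
      have e : x₁.im = δ₀ * ⌊v.im / δ₀⌋ := by simp [hx₁, ha₁, meshPoint_im]
      obtain ⟨h1, h2⟩ := hfl v.im
      rw [e, abs_le]
      constructor <;> linarith
    have hd : dist x₁ v ≤ |x₁.re - v.re| + |x₁.im - v.im| := by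
      rw [Complex.dist_eq]
      simpa only [Complex.sub_re, Complex.sub_im] using Complex.norm_le_abs_re_add_abs_im (x₁ - v)
    linarith
  have hx₁₂ : dist x₁ x₂ = δ₀ := by
    rw [hx₁, hx₂, dist_meshPoint_of_adj ((zdGraph_adj_iff _ _).2 ⟨0, Or.inl rfl⟩),
      abs_of_pos hδ₀pos]
  have hx₂v : dist x₂ v ≤ 3 * δ₀ := by
    linarith [dist_triangle x₂ x₁ v, dist_comm x₁ x₂]
  have hx₂re : x₂.re = x₁.re + δ₀ := by
    simp [hx₁, hx₂, meshPoint_re]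
    ring
  set y₂ : ℂ := x₂ + ((δ₀ / 2 : ℝ) : ℂ) with hy₂
  have hx₂y₂ : dist x₂ y₂ = δ₀ / 2 := by
    rw [hy₂, dist_self_add_right, Complex.norm_real, Real.norm_eq_abs, abs_of_pos (by positivity)]
  refine ⟨M₀, a₁, hM₀ne, hballV (by rw [mem_ball]; linarith), hballV (by rw [mem_ball]; linarith),
    fun w hw => ?_, fun hx => ?_, fun e => ?_⟩
  · -- the segment lies in `V`
    have hsub : segment ℝ x₂ y₂ ⊆ closedBall x₂ (δ₀ / 2) :=
      (convex_closedBall _ _).segment_subset (mem_closedBall_self (by positivity))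
        (by rw [mem_closedBall, dist_comm, hx₂y₂])
    have hw' := hsub hw
    rw [mem_closedBall] at hw'
    refine hballV ?_
    rw [mem_ball]
    linarith [dist_triangle w x₂ v]
  · -- the first point is to the left of the segment
    rw [segment_eq_image'] at hx
    obtain ⟨θ, hθ, hθx⟩ := hx
    have := congrArg Complex.re hθx
    simp only [Complex.add_re, Complex.real_smul, Complex.mul_re, Complex.ofReal_re,
      Complex.ofReal_im, add_sub_cancel_left, zero_mul, sub_zero] at this
    nlinarith [hθ.1, hx₂re, hδ₀pos]
  · rw [← dist_eq_zero, hx₂y₂] at e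
    linarith

end Summit.CriticalPhenomena.CardyFormulaZ2.Cruxes.LagHandOff.HittingTournament

end
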